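import Mathlib
import Literature.Analysis.FluidPDE.HardSpherePhaseSpace
import Literature.MathematicalPhysics.KineticTheory.HardSphereEuler

/-!
# Sketch — crux-ideate stmt-AtomisticToContinuum-9519 (AprioriBounds), ideator 1 (gen 2), round 1

First lemmas of the two idea cards of this seat:

* card `moderator-cascade-dispersing` (part (i), destruction-in-energy): §1 frozen-target kinematics
  (retained energy `= ‖v‖² - ⟪v,ω⟫²`, i.e. `b²/ε²` of the energy is kept — the neutron-in-hydrogen
  law), §2 the moderation mgf identity `∫₀¹ e^{xu} du = (eˣ - 1)/x` and the supermartingale threshold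
  `x ≥ 2`, §3 one-flight expansion `|dχ/db| ≥ 2/ε` of the hard-sphere scattering angle.
* card `santalo-sojourn-identity` (part (i), sojourn-in-time): §6 the typed DETERMINISTIC localised
  Santaló bound `LocalSantaloBound` (the lever), §4 the abstract Markov-integrated sojourn bound (typed),
  §5 the typed equilibrium statement `VoidCostExtensive` (fallback variant: bulk visibility excess has
  super-extensive upper-tail cost, rate `→ ∞` as `σ → 0`).
-/

noncomputable section

open MeasureTheory Real Set Filter Topology
open scoped InnerProductSpace ENNReal

namespace Summit.AtomisticToContinuum.HydrodynamicLimit.Cruxes.AprioriBounds.IdeatorOneG2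

open Literature.Analysis.FluidPDE Literature.MathematicalPhysics.KineticTheory

/-! ## §1 Frozen-target kinematics: the fast sphere keeps `‖v‖² - ⟪v,ω⟫²` -/

section Kinematics

variable {E : Type*} [NormedAddCommGroup E] [InnerProductSpace ℝ E]

/-- Hitting a target AT REST (`w = 0`) with unit impact normal `ω`, the projectile keeps exactly
`‖v‖² - ⟪v, ω⟫²` of its kinetic energy (tree law `reflectVel`).  With impact parameter `b` on a
sphere of diameter-sum `ε`, `⟪v̂, ω⟫² = 1 - b²/ε²`, so the retained FRACTION is `b²/ε²`:
uniform impact parameter on the disc ⇒ retained fraction ~ Uniform[0,1] (Fermi's slowing-down law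
for equal masses). -/
theorem frozen_target_retained_energy {ω : E} (hω : ‖ω‖ = 1) (v : E) :
    ‖(reflectVel ω (v, (0 : E))).1‖ ^ 2 = ‖v‖ ^ 2 - ⟪v, ω⟫_ℝ ^ 2 := by
  simp only [reflectVel, sub_zero, hω, one_pow, div_one]
  rw [@norm_sub_sq_real, norm_smul, Real.norm_eq_abs, hω, mul_one, inner_smul_right, sq_abs]
  ring

/-- … and the target picks up exactly `⟪v, ω⟫²` (energy bookkeeping of the pair). -/
theorem frozen_target_transferred_energy {ω : E} (hω : ‖ω‖ = 1) (v : E) :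
    ‖(reflectVel ω (v, (0 : E))).2‖ ^ 2 = ⟪v, ω⟫_ℝ ^ 2 := by
  simp only [reflectVel, sub_zero, hω, one_pow, div_one, zero_add]
  rw [norm_smul, Real.norm_eq_abs, hω, mul_one, sq_abs]

end Kinematics

/-! ## §1b Uniform impact parameter on the disc ⇒ Uniform[0,1] retained fraction (Fermi's law) -/

/-- Under the uniform law on the impact disc of radius `ε` (radial density `2b/ε²` on `[0, ε]`), the
retained fraction `u = b²/ε²` is Uniform[0,1]: for every continuous `f`,
`∫₀^ε f(b²/ε²)·(2b/ε²) db = ∫₀¹ f(u) du` (change of variables). Combined with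
`frozen_target_retained_energy` and `integral_exp_mul_unit`: `𝔼 e^{λ u E} = (e^{λE} - 1)/(λE)`. -/
theorem disc_uniform_retained_fraction {ε : ℝ} (hε : 0 < ε) {f : ℝ → ℝ} (hf : Continuous f) :
    ∫ b in (0 : ℝ)..ε, f (b ^ 2 / ε ^ 2) * (2 * b / ε ^ 2) = ∫ u in (0 : ℝ)..1, f u := by
  have hderiv : ∀ b ∈ Set.uIcc (0 : ℝ) ε, HasDerivAt (fun b : ℝ => b ^ 2 / ε ^ 2) (2 * b / ε ^ 2) b := by
    intro b _
    have h1 : HasDerivAt (fun b : ℝ => b ^ 2) (2 * b) b := by simpa using hasDerivAt_pow 2 b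
    have h2 := h1.div_const (ε ^ 2)
    simpa [mul_div_assoc] using h2
  have hcont : ContinuousOn (fun b : ℝ => 2 * b / ε ^ 2) (Set.uIcc (0 : ℝ) ε) := by fun_prop
  have := intervalIntegral.integral_comp_mul_deriv hderiv hcont hf
  have hε2 : ε ^ 2 / ε ^ 2 = 1 := div_self (by positivity)
  simpa [hε2] using this

/-! ## §2 The moderation mgf identity and the supermartingale threshold -/

/-- `∫₀¹ e^{x u} du = (eˣ - 1)/x` for `x ≠ 0`: the exponential moment of a Uniform[0,1] fraction of
the energy level `x = λE`. -/
theorem integral_exp_mul_unit {x : ℝ} (hx : x ≠ 0) :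
    ∫ u in (0 : ℝ)..1, Real.exp (x * u) = (Real.exp x - 1) / x := by
  have h : ∀ u ∈ Set.uIcc (0 : ℝ) 1, HasDerivAt (fun u => Real.exp (x * u) / x) (Real.exp (x * u)) u := by
    intro u _
    have h1 : HasDerivAt (fun u => x * u) x u := by simpa using (hasDerivAt_id u).const_mul x
    have h2 : HasDerivAt (fun u => Real.exp (x * u)) (Real.exp (x * u) * x) u := h1.exp
    have h3 := h2.div_const x
    simp only [mul_div_assoc, div_self hx, mul_one] at h3
    exact h3
  rw [intervalIntegral.integral_eq_sub_of_hasDerivAt h (by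
    apply Continuous.intervalIntegrable; fun_prop)]
  simp [mul_one, mul_zero, sub_div]

/-- Supermartingale threshold: once `λE = x ≥ 2`, a Uniform[0,1] retained fraction halves the
exponential moment in conditional mean: `(eˣ - 1)/x ≤ eˣ/2`.  (With a density in
`[1-δ, 1+δ] ×` uniform the factor is `(1+δ)/2`; constant slack costs level, not rate.) -/
theorem moderation_contracts {x : ℝ} (hx : 2 ≤ x) : (Real.exp x - 1) / x ≤ Real.exp x / 2 := by
  have hxpos : 0 < x := by linarith
  rw [div_le_div_iff₀ hxpos (by norm_num : (0:ℝ) < 2)]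
  nlinarith [Real.exp_pos x, Real.add_one_le_exp x]

/-! ## §3 One-flight expansion: the scattering angle moves at rate `≥ 2/ε` in the impact parameter -/

/-- Scattering (deflection) angle of a point projectile specularly reflected by a fixed sphere,
impact parameter `b`, sum of radii `ε`: `χ(b) = π - 2 arcsin(b/ε)`. -/
def scatteringAngle (ε b : ℝ) : ℝ := Real.pi - 2 * Real.arcsin (b / ε)

/-- `χ'(b) = -2 / (ε √(1 - b²/ε²))` for `|b| < ε`. -/
theorem hasDerivAt_scatteringAngle {ε b : ℝ} (hε : 0 < ε) (hb : |b| < ε) :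
    HasDerivAt (scatteringAngle ε) (-(2 * ((Real.sqrt (1 - (b / ε) ^ 2))⁻¹ * ε⁻¹))) b := by
  have hb1 : b / ε ≠ -1 := by
    intro h
    have : b = -ε := by field_simp at h; linarith
    rw [this, abs_neg, abs_of_pos hε] at hb; exact lt_irrefl _ hb
  have hb2 : b / ε ≠ 1 := by
    intro h
    have : b = ε := by field_simp at h; linarith
    rw [this, abs_of_pos hε] at hb; exact lt_irrefl _ hb
  have h1 : HasDerivAt (fun b => b / ε) ε⁻¹ b := by
    simpa [div_eq_mul_inv] using (hasDerivAt_id b).mul_const ε⁻¹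
  have h2 : HasDerivAt (fun b => Real.arcsin (b / ε)) ((Real.sqrt (1 - (b / ε) ^ 2))⁻¹ * ε⁻¹) b := by
    have := (Real.hasDerivAt_arcsin hb1 hb2).comp b h1
    simpa [Function.comp_def, one_div] using this
  have h3 := (h2.const_mul 2).const_sub Real.pi
  show HasDerivAt (fun b => Real.pi - 2 * Real.arcsin (b / ε)) _ b
  exact h3

/-- **One-flight expansion.** `|χ'(b)| ≥ 2/ε`: an uncertainty `δb` in the impact parameter becomes
an angular uncertainty `≥ 2δb/ε`, hence a transverse offset `≥ 2ℓδb/ε` after a flight of length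
`ℓ`; in the crux's scaling `ℓ_N/ε_N = 1/(π σ³ ρ)` (diluteness = expansion factor). -/
theorem two_div_le_abs_deriv_scatteringAngle {ε b : ℝ} (hε : 0 < ε) (hb : |b| < ε) :
    2 / ε ≤ |deriv (scatteringAngle ε) b| := by
  have hlt : (b / ε) ^ 2 < 1 := by
    have : |b / ε| < 1 := by rw [abs_div, abs_of_pos hε, div_lt_one hε]; exact hb
    exact (sq_lt_one_iff_abs_lt_one _).2 this
  have hpos : 0 < 1 - (b / ε) ^ 2 := by linarith
  have hsqrt_pos : 0 < Real.sqrt (1 - (b / ε) ^ 2) := Real.sqrt_pos.2 hpos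
  have hsqrt_le : Real.sqrt (1 - (b / ε) ^ 2) ≤ 1 := by
    rw [Real.sqrt_le_one]; nlinarith [sq_nonneg (b / ε)]
  have key : (1:ℝ) ≤ (Real.sqrt (1 - (b / ε) ^ 2))⁻¹ := by
    rw [le_inv_comm₀ one_pos hsqrt_pos, inv_one]; exact hsqrt_le
  rw [(hasDerivAt_scatteringAngle hε hb).deriv, abs_neg, abs_of_pos (by positivity)]
  calc 2 / ε = 2 * (1 * ε⁻¹) := by rw [one_mul, div_eq_mul_inv]
    _ ≤ 2 * ((Real.sqrt (1 - (b / ε) ^ 2))⁻¹ * ε⁻¹) := by gcongr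

/-! ## §4 Markov-integrated sojourn (abstract): mean free path `ℓ` ⇒ capped mean sojourn `≤ ℓ(1 + log(c/ℓ))` -/

/-- **Santaló–Markov sojourn bound (abstract form, typed; proof = layer cake + Markov).**  For a
nonnegative random variable `T` with `𝔼 T ≤ ℓ` (Santaló's mean-free-path identity supplies exactly
this for EVERY scatterer configuration, w.r.t. the invariant boundary measure) and a cap `c ≥ ℓ`,
`𝔼[min T c] ≤ ℓ (1 + log (c/ℓ))`: worst-case (channelled) geometry costs only a logarithm — the
logarithm that card `mean-free-volume-void-cost` removes with ONE extensive input. -/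
def MarkovSojournBound : Prop :=
  ∀ (Ω : Type) [MeasurableSpace Ω] (P : Measure Ω) [IsProbabilityMeasure P] (T : Ω → ℝ),
    Measurable T → (∀ ω, 0 ≤ T ω) → ∀ ℓ c : ℝ, 0 < ℓ → ℓ ≤ c → Integrable T P →
    (∫ ω, T ω ∂P) ≤ ℓ → (∫ ω, min (T ω) c ∂P) ≤ ℓ * (1 + Real.log (c / ℓ))

/-! ## §5 Typed equilibrium input of card `mean-free-volume-void-cost` -/

/-- Mean free path at unit number density in the crux's scaling: `ℓ_N = (N+1)^{-1/3}/(π σ²)`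
(`(N+1) · π ε_N² · ℓ_N = 1` with `ε_N = hsDiameter σ N`). -/
def meanFreePath (σ : ℝ) (N : ℕ) : ℝ := ((N + 1 : ℕ) : ℝ) ^ (-(1 / 3 : ℝ)) / (Real.pi * σ ^ 2)

/-- Frozen CONTACT free path: sphere `j` of the configuration `z` is the scatterer just hit; the
projectile's centre sits at the contact point `x_j + ε ω` (`ω ∈ S²`) and is launched in direction `d`
with all other centres frozen; the value is the first `s > 0` at which it comes within `ε` of another
centre `k ≠ j` (torus displacement realised through the tree's `freeFlight` for unit time with
velocity `ε ω + s d`); `sInf ∅ = 0` is the junk value (never hit ⇒ capped anyway). -/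
def contactFreePath {N : ℕ} (ε : ℝ) (z : Config N (Fin 3) T3) (j : Fin N) (ω d : V3) : ℝ :=
  sInf {s : ℝ | 0 < s ∧ ∃ k : Fin N, k ≠ j ∧
    Torus.euclidDist ((freeFlight (Torus.geometry (Fin 3)) 1
      (Function.update z j ((z j).1, ε • ω + s • d)) j).1) (z k).1 ≤ ε}

/-- Direction average over the unit sphere of `V3` (surface measure `volume.toSphere`,
normalised to a probability). -/
def sphereAvg (f : V3 → ℝ) : ℝ :=
  (∫ d, f (d : V3) ∂((volume : Measure V3).toSphere)) /
    (((volume : Measure V3).toSphere) Set.univ).toReal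

/-- Santaló (collision-space) average of the capped contact free path from scatterer `j`: uniform
contact point `ω`, outgoing direction `d` with the invariant cosine weight `4·max(⟪d,ω⟫,0)`
(normalised: `E_d[4 max(⟪d,ω⟫,0)] = 1`). -/
def contactCappedMean {N : ℕ} (ε : ℝ) (z : Config N (Fin 3) T3) (j : Fin N) (c : ℝ) : ℝ :=
  sphereAvg fun ω => sphereAvg fun d =>
    4 * max (⟪d, ω⟫_ℝ) 0 * min (contactFreePath ε z j ω d) c

/-- The bulk capped free-path functional of a configuration: `N⁻¹ ∑ⱼ contactCappedMean`. -/
def bulkCappedFreePath {N : ℕ} (ε c : ℝ) (z : Config N (Fin 3) T3) : ℝ :=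
  (N : ℝ)⁻¹ * ∑ j : Fin N, contactCappedMean ε z j c

/-- **VoidCostExtensive (typed lever of card `mean-free-volume-void-cost`).**  Under the
flow-invariant homogeneous Gibbs law `G_N = localGibbsLaw σ 1 0 θe`, an excess of the bulk capped
free path over `C ℓ_N` costs MORE than any prescribed extensive rate `K` once `σ` is small:
`∀ K ∃ σ₀ ∀ σ < σ₀ ∃ C L, G_N{bulkCappedFreePath > C ℓ_N} ≤ e^{-K(N+1)}` for all `N` and all flows
(the law does not depend on the flow).  Heuristic: a mean-free volume holds `1/(π³σ⁶ρ²)` particles, so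
voids/channels of mean-free-path size are `e^{-cσ⁻⁶}`-rare per site and a bulk excess is a speed-`N`
large deviation with rate `≍ σ⁻⁶`; `K` is then chosen above the entropy-per-particle `C₀(profiles)`
of the local Gibbs data and the event is moved to time `s` by the routes' TransferInequality. -/
def VoidCostExtensive : Prop :=
  ∀ θe : ℝ, 0 < θe → ∀ K : ℝ, ∃ σ₀ : ℝ, 0 < σ₀ ∧ ∀ σ : ℝ, 0 < σ → σ < σ₀ → ∃ C L : ℝ, 0 < C ∧ 0 < L ∧
    ∀ (N : ℕ) (Φ : HardSphereFlow (Torus.geometry (Fin 3)) (hsDiameter σ N) (N + 1)),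
      localGibbsLaw σ (fun _ => 1) (fun _ => 0) (fun _ => θe) N Φ
        {z | C * meanFreePath σ N < bulkCappedFreePath (hsDiameter σ N) (L * meanFreePath σ N) z}
        ≤ ENNReal.ofReal (Real.exp (-(K * ((N : ℝ) + 1))))

/-! ## §6 Typed deterministic lever of card `santalo-sojourn-identity`: localised Santaló bound -/

/-- **LocalSantaloBound (typed; the deterministic lever of card `santalo-sojourn-identity`).**
For EVERY configuration `z` of `N` centres with hard-core spacing `ε` on `𝕋³`, every ball `B(x,h)` holding
`n ≥ 1` centres and every cap `c > 0` (with `h + ε + c ≤ 1/4`, inside the injectivity radius): the average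
over the scatterers `j ∈ B(x,h)` of the Santaló-averaged capped contact free path is at most
`(4/3)(h + ε + c)³ / (n ε²)`.  Proof idea (integral geometry, no probability): the flow-out map
`(j, ω, d, s) ↦ (x_j + εω + s d, d)`, `0 < s < min(T, c)`, is injective into `B(x, h+ε+c) × S²` and carries
the measure `ε² cos dω dd ds` to Liouville measure (Santaló / Chernov 1997 mean-free-path identity
`∫_∂ T cos = |S²|·|Q|`, localised and capped).  With `n ≥ c₁h³(N+1)` (the crux's own (ii)) and
`c = Lℓ_N ≪ h` the right side is `(4π/3)(1 + (ε + c)/h)³ · ℓ_N/c₁`, `ℓ_N = ((N+1)πε²)⁻¹`: the cell's mean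
capped free path is `O(ℓ_N/c₁)` for every configuration — foam, cluster or channel. -/
def LocalSantaloBound : Prop :=
  ∀ (N : ℕ) (ε h c : ℝ), 0 < ε → 0 < h → 0 < c → h + ε + c ≤ 1 / 4 →
    ∀ (z : Config N (Fin 3) T3) (x : T3),
      (∀ i j : Fin N, i ≠ j → ε ≤ Torus.euclidDist (z i).1 (z j).1) →
      let cell := (Finset.univ.filter fun j : Fin N => Torus.euclidDist (z j).1 x ≤ h)
      1 ≤ cell.card →
        (cell.card : ℝ)⁻¹ * ∑ j ∈ cell, contactCappedMean ε z j c
          ≤ (4 / 3) * (h + ε + c) ^ 3 / ((cell.card : ℝ) * ε ^ 2)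

end Summit.AtomisticToContinuum.HydrodynamicLimit.Cruxes.AprioriBounds.IdeatorOneG2

end
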